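import Summits.CriticalPhenomena.PercolationContinuityZ3.Theorems.Transplant.HexShadowFact2Reduction
import Summits.CriticalPhenomena.PercolationContinuityZ3.Theorems.Transplant.TriFilmScope
import HarnessLib

/-!
# The `(111)`-films and the triangular films at their own critical point, MODULO THE ROUTING NODE `HexLocatedSurgeries` alone — the end of the gen-32 chain

builds on p205010 (kernel theorem, internal audit signed; external expert review pending) — NOT used in this file.  Lane `prim-bschramm`, seat
`prim-bschramm-p2` (gen 32; class C1b; memo `HOME/bschramm/P2-LATTICES.md` §115–§118); helper file (`--supports stmt-CriticalPhenomena-4575 --as helper`).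

Of Duminil-Copin–Sidoravicius–Tassion's proof (Thm. 1, §2.1–§2.3) transplanted to hexagonal symmetry, the tree now PROVES, for every graph with a hexagonal
shadow: eq. (1) from uniqueness, Lemma 4, Lemma 5, eqs. (10)–(13), the renormalisation §2.2, the assembly, the degenerate density `p = 1` (connectedness), Lemma 7,
Fact 1 (planar crossing by the subdivision embedding of `𝕋`), the Gluing Lemma from Facts 1–2, the surgery core (`ω^{(z)}`, the exchange lemma, the recovery
statistic), and Fact 2 from located surgeries.  What remains is the ROUTING `HexShadow.HexLocatedSurgeries` (DST p. 6: "three disjoint self-avoiding paths in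
`B̄_R(z) ∖ {z}`" — the only place where the local structure of the instance enters).  This file records the two film rows modulo that single node.
[cite: DuminilCopinSidoraviciusTassion2016, Thm. 1, Lemma 6, §2.3] [cite: BenjaminiSchramm1996, Conj. 4 / Question 3]
-/

noncomputable section

namespace Summit.CriticalPhenomena.PercolationContinuityZ3.Theorems.Transplant

open MeasureTheory Literature.Probability.Percolation Literature.Probability.LatticeModels SimpleGraph

/-- **THE `(111)`-FILM THEOREM MODULO THE ROUTING**: for every `k ≥ 1`, located surgeries for the shadow of `F_k = {0 ≤ x₀+x₁+x₂ ≤ k}` give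
`Slab111OwnCriticalContinuity k` (the film dies at its own critical point at every vertex).  Independent of p205010.
[cite: DuminilCopinSidoraviciusTassion2016, Thm. 1, §2.3] [cite: BenjaminiSchramm1996, Conj. 4 / Question 3] -/
theorem slab111OwnCriticalContinuity_of_locatedSurgeries {k : ℕ} (hk : 1 ≤ k) (h : (Slab111.hexShadow k).HexLocatedSurgeries) :
    Slab111OwnCriticalContinuity k :=
  slab111OwnCriticalContinuity_of_hexGluing hk ((Slab111.hexShadow k).hexGluing_of_locatedSurgeries h)

/-- **THE TRIANGULAR FILMS MODULO THE ROUTING**: for every `k`, located surgeries for the shadow of `𝕋 × {0..k}` give `θ_v(p_c) = 0` at every vertex.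
[cite: DuminilCopinSidoraviciusTassion2016, Thm. 1, §2.3] [cite: BenjaminiSchramm1996, Conj. 4 / Question 3] -/
theorem TriFilm.theta_criticalProb_eq_zero_of_locatedSurgeries (k : ℕ) (h : (TriFilm.hexShadow k).HexLocatedSurgeries) (v : triFilm k) :
    theta (TriFilm.film k) v (criticalProbIOf (TriFilm.film k) v) = 0 :=
  TriFilm.theta_criticalProb_eq_zero_of_hexGluing' k ((TriFilm.hexShadow k).hexGluing_of_locatedSurgeries h) v

end Summit.CriticalPhenomena.PercolationContinuityZ3.Theorems.Transplant

end
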